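import Literature.Barriers.HodgeConjecture.DecompositionOfTheDiagonal
import Literature.AlgebraicGeometry.Motives.BettiRealizationWeil
import Literature.AlgebraicGeometry.Motives.CyclesAbelianVarietiesProofs
import HarnessLib

/-!
# The `B`-parametrised barrier fact of `DecompositionOfTheDiagonal` is not dischargeable: Weil re-decoration of a Betti–Hodge datum

`Literature.Barriers.HodgeConjecture.BlochSrinivas1983_hodgeNumbers_vanish_of_chowZeroSupported B`
(Voisin II, Thm. 10.4 / Thm. 10.17, rendered on the abstract Betti–Hodge layer) is a `Prop`
PARAMETRISED by a Betti–Hodge realization datum `B : BettiHodgeData ℂ`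
(`Motives/BettiRealization`): a hypothesis structure consisting of a Weil cohomology `W`, a
comparison with Betti cohomology, and, for each smooth projective `X` and each `i`, SOME pure
Hodge structure `B.hodge hX i` of weight `i` on `Hⁱ(X)`, subject only to (a) pull-backs are
morphisms of Hodge structures, (b) each `B.hodge hX i` is polarizable, (c) cycle classes are
Hodge classes (an even-degree condition). Its would-be discharge
`theorem …_holds : ∀ B, BlochSrinivas1983_hodgeNumbers_vanish_of_chowZeroSupported B` is not
what the source proves (Voisin proves the theorem for THE Hodge structure of `X`), and this file
shows that it does not follow from the axioms (a)–(c): from ANY datum `B` one builds another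
datum `B.weil` (`BettiHodgeData.weil` in `Motives/BettiRealizationWeil`) with the same `W` and
comparison, whose Hodge structures in odd degree `i` are replaced by Weil's two-type structures
`(B.hodge hX i).weil`
(`Motives/HodgeStructureWeil`: `V^{i,0} = ⊕_{p odd} V^{p,i-p}`, `V^{0,i}` its conjugate —
Weil's weight-one structure `(H, C)` of Carlson–Müller-Stach–Peters, *Period Mappings and Period
Domains*, §3.5, eq. (3.5), types relabelled), and unchanged in even degree. `H ↦ H.weil` is
functorial and preserves polarizability, and even degrees are untouched, so (a)–(c) still hold;
but `h^{l,0}(B.weil, X) = ½ b_l(X)` for odd `l` (`two_mul_hodgeNumber_weil`). Consequently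
(`not_blochSrinivas1983_hodgeNumbers_vanish_weil`,
`BlochSrinivas1983_hodgeNumbers_vanish_of_chowZeroSupported_not_forall`): if some smooth
projective `X` has `CH₀` supported in dimension `≤ d` and a non-zero Betti group `Hˡ(X(ℂ); ℚ)` in
some ODD degree `l > d`, then the fact FAILS for `B.weil`, whence `¬ ∀ B, fact B` as soon as one
datum `B : BettiHodgeData ℂ` exists. Classically both hypotheses are met — the Betti–Hodge
realization exists (Hodge decomposition, Voisin I, Thm. 6.19, §7.1, Prop. 11.20), and e.g. for
`X = C × ℙ¹`, `C` a smooth projective curve of genus `g ≥ 1`, the group `CH₀(X) ≅ CH₀(C)` is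
carried by the curve `C × {pt}` (Chow groups of a projective bundle, Voisin II, Thm. 9.25), so
`CH₀(X)` is supported in dimension `d = 1`, while `H³(X, ℚ) ≅ H¹(C, ℚ) ⊗ H²(ℙ¹, ℚ)` has dimension
`2g ≠ 0` (Künneth), `l = 3` — but neither is constructed in the tree, so they enter as
hypotheses. The corrected, `B`-free rendering of Thm. 10.4 / 10.17 that the source does prove
is `BlochSrinivas1983_hodgeTypeL0_vanish_of_chowZeroSupported` in the statement file.

## Main statements

* `not_blochSrinivas1983_hodgeNumbers_vanish_weil`: the fact fails for `B.weil` given a smooth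
  projective `X` with `CH₀` supported in dimension `≤ d` and `Hˡ(X(ℂ); ℚ) ≠ 0`, `l > d` odd.
* `BlochSrinivas1983_hodgeNumbers_vanish_of_chowZeroSupported_not_forall`: hence
  `¬ ∀ B, BlochSrinivas1983_hodgeNumbers_vanish_of_chowZeroSupported B` (given one datum `B`).
* `subsingleton_bettiCohomology_of_forall_blochSrinivas1983`: contrapositive form.
* (v2) `hasChowZeroSupportedInDimLE_self`: `CH₀(X)` is trivially supported on `W = X` in
  dimension `≤ dim X`, so the witness needs no Chow-theoretic input:
  `not_blochSrinivas1983_hodgeNumbers_vanish_weil_of_lt` (any odd `b_l(X) ≠ 0`, `l > dim X`,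
  refutes the fact for `B.weil`), and, by Poincaré duality for `B.W`,
  `finrank_bettiCohomology_eq_zero_of_forall_blochSrinivas1983` (`∀ B, fact B` forces
  `b_j(X) = 0` for every odd `j ≠ dim X`), `finrank_bettiCohomology_one_eq_zero_of_forall_blochSrinivas1983`
  (`b₁(X) = 0` whenever `dim X ≥ 2`) and
  `BlochSrinivas1983_hodgeNumbers_vanish_of_chowZeroSupported_not_forall_of_bettiOne`
  (one smooth projective `X` of dimension `≥ 2` with `H¹(X(ℂ); ℚ) ≠ 0` refutes `∀ B, fact B`).

## References

* C. Voisin, *Hodge Theory and Complex Algebraic Geometry II*, CUP 2003, Thm. 10.4, Thm. 10.17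
  (statement for the Hodge structure of `X`: `H⁰(X, Ω^k_X) = 0`), proof pp. 259–260.
* J. Carlson, S. Müller-Stach, C. Peters, *Period Mappings and Period Domains*, 2nd ed.,
  CUP 2017, §3.5, eq. (3.5) (Weil's Hodge structure `(H, C)` and its polarization).
-/

noncomputable section

open CategoryTheory AlgebraicGeometry

namespace Literature.Barriers.HodgeConjecture

open Literature.AlgebraicGeometry.Motives

/-! ### The verdict on the `B`-parametrised fact -/

/-- **The `B`-parametrised barrier fact fails for a Weil re-decorated datum.** If a smooth
projective `X` has `CH₀` supported in dimension `≤ d` and a non-zero Betti group `Hˡ(X(ℂ); ℚ)`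
in some odd degree `l > d`, then `BlochSrinivas1983_hodgeNumbers_vanish_of_chowZeroSupported`
is FALSE for the datum `B.weil`, whatever `B` is: `h^{l,0}(B.weil, X) = ½ b_l(X) ≠ 0`. (Voisin II,
Thm. 10.4 / 10.17 is a theorem about the Hodge structure OF `X`, `H^{l,0}(X) = H⁰(X, Ω^l_X)`; the
axioms of `BettiHodgeData` do not pin down odd-degree Hodge numbers.)
[cite: VoisinHodgeII2003, Thm. 10.4 and Thm. 10.17] [cite: CarlsonMullerStachPeters2017, §3.5 eq. (3.5)] -/
theorem not_blochSrinivas1983_hodgeNumbers_vanish_weil (B : BettiHodgeData ℂ) {n : ℕ}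
    {X : SchemeOver ℂ} (hX : IsSmoothProjective n X) {d l : ℕ} (hW : HasChowZeroSupportedInDimLE X d)
    (hdl : d < l) (hl : Odd l) (hb : Nontrivial (bettiCohomology X l)) :
    ¬ BlochSrinivas1983_hodgeNumbers_vanish_of_chowZeroSupported B.weil :=
  fun h ↦ B.hodgeNumber_weil_ne_zero hX hl hb (h hX d hW l hdl)

/-- **Non-dischargeability of the `B`-parametrised fact.** Under the same (classically true,
here hypothetical) witness — one Betti–Hodge datum `B : BettiHodgeData ℂ` and one smooth
projective `X` with `CH₀` supported in dimension `≤ d` and `Hˡ(X(ℂ); ℚ) ≠ 0` for an odd `l > d`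
(e.g. `X = C × ℙ¹`, `g(C) ≥ 1`, `d = 1`, `l = 3`: Voisin II, Thm. 9.25 and Künneth) — the
universal closure `∀ B, BlochSrinivas1983_hodgeNumbers_vanish_of_chowZeroSupported B`, i.e. the
would-be `…_holds`, is false. The statement the source proves is the `B`-free
`BlochSrinivas1983_hodgeTypeL0_vanish_of_chowZeroSupported`.
[cite: VoisinHodgeII2003, Thm. 10.4 and Thm. 10.17] [cite: CarlsonMullerStachPeters2017, §3.5 eq. (3.5)] -/
theorem BlochSrinivas1983_hodgeNumbers_vanish_of_chowZeroSupported_not_forall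
    (B : BettiHodgeData ℂ) {n : ℕ} {X : SchemeOver ℂ} (hX : IsSmoothProjective n X) {d l : ℕ}
    (hW : HasChowZeroSupportedInDimLE X d) (hdl : d < l) (hl : Odd l)
    (hb : Nontrivial (bettiCohomology X l)) :
    ¬ ∀ B' : BettiHodgeData ℂ, BlochSrinivas1983_hodgeNumbers_vanish_of_chowZeroSupported B' :=
  fun h ↦ not_blochSrinivas1983_hodgeNumbers_vanish_weil B hX hW hdl hl hb (h B.weil)

/-- Equivalently: if a single Betti–Hodge datum exists and the fact holds for ALL data, then no
smooth projective `X` with `CH₀` supported in dimension `≤ d` has non-zero Betti cohomology in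
an odd degree `l > d`. [cite: VoisinHodgeII2003, Thm. 10.4 and Thm. 10.17] -/
theorem subsingleton_bettiCohomology_of_forall_blochSrinivas1983 (B : BettiHodgeData ℂ)
    (h : ∀ B' : BettiHodgeData ℂ, BlochSrinivas1983_hodgeNumbers_vanish_of_chowZeroSupported B')
    {n : ℕ} {X : SchemeOver ℂ} (hX : IsSmoothProjective n X) {d l : ℕ}
    (hW : HasChowZeroSupportedInDimLE X d) (hdl : d < l) (hl : Odd l) :
    Subsingleton (bettiCohomology X l) := by
  by_contra hV
  exact BlochSrinivas1983_hodgeNumbers_vanish_of_chowZeroSupported_not_forall B hX hW hdl hl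
    (not_subsingleton_iff_nontrivial.1 hV) h

/-! ### Appended (v2): the witness freed of Chow-theoretic input — `W = X`, odd Betti numbers off the middle degree, `b₁`

The hypothesis "`CH₀(X)` supported in dimension `≤ d`" of the fact is FREE for `d = dim X`
(`W = X`: every point of the smooth projective `n`-fold `X` has height `≤ n`,
`IsSmoothProjective.height_le`), and for `d = n` the fact asserts `h^{l,0}(B, X) = 0` for all
`l > n` — true for the Hodge structure OF `X` (`H⁰(X, Ω^l_X) = 0`, `l > dim X`), false for the
Weil re-decoration `B.weil` as soon as some odd Betti number `b_l(X)`, `l > n`, is non-zero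
(`h^{l,0}(B.weil, X) = ½ b_l(X)`). By Poincaré duality for the Weil cohomology `B.W ≅ H_B`
(axiom (A), Kleiman 1968, §1.2) `b_l = b_{2n-l}`, so the universal closure `∀ B, fact B` forces
`b_j(X) = 0` for EVERY odd `j ≠ n` and every smooth projective `X` over `ℂ` — in particular
`b₁(X) = 0` whenever `dim X ≥ 2`, which fails for every abelian variety of dimension `≥ 2`
(`b₁ = 2 dim`) and every product of curves of positive genus (`b₁(C × C') = 2g + 2g'`, Künneth).
The remaining inputs of the refutation are thus exactly: one datum `B : BettiHodgeData ℂ`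
(classical Hodge theory) and one smooth projective `X`, `dim X ≥ 2`, with `H¹(X(ℂ); ℚ) ≠ 0` —
neither constructed in the tree. -/

section TrivialSupport

variable {n : ℕ} {X : SchemeOver ℂ}

/-- `CH₀(X)` of a smooth projective `X` of dimension `n` is supported in dimension `≤ n`, on
`W = X` itself: every point of `X` has height `≤ n` (`IsSmoothProjective.height_le`) and every
`0`-cycle is rationally equivalent to itself. The hypothesis of Thm. 10.4 with `k = dim X` is
therefore vacuous. [cite: VoisinHodgeII2003, Thm. 10.4 and §10.1.1] -/
theorem hasChowZeroSupportedInDimLE_self (hX : IsSmoothProjective n X) :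
    HasChowZeroSupportedInDimLE X n :=
  hasChowZeroSupportedInDimLE_of_forall_height_le fun w ↦ hX.height_le w

/-- **The `B`-parametrised fact fails for `B.weil` on any smooth projective `X` with a non-zero
odd Betti number above the middle degree:** for `l` odd, `dim X < l`, `Hˡ(X(ℂ); ℚ) ≠ 0`, the datum
`B.weil` has `h^{l,0}(X) = ½ b_l(X) ≠ 0`, while `CH₀(X)` is (trivially) supported in dimension
`≤ dim X < l`. [cite: VoisinHodgeII2003, Thm. 10.4 and Thm. 10.17]
[cite: CarlsonMullerStachPeters2017, §3.5 eq. (3.5)] -/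
theorem not_blochSrinivas1983_hodgeNumbers_vanish_weil_of_lt (B : BettiHodgeData ℂ)
    (hX : IsSmoothProjective n X) {l : ℕ} (hnl : n < l) (hl : Odd l)
    (hb : Nontrivial (bettiCohomology X l)) :
    ¬ BlochSrinivas1983_hodgeNumbers_vanish_of_chowZeroSupported B.weil :=
  not_blochSrinivas1983_hodgeNumbers_vanish_weil B hX (hasChowZeroSupportedInDimLE_self hX) hnl hl hb

/-- If the fact held for ALL Betti–Hodge data, every smooth projective `X` over `ℂ` would have
`Hˡ(X(ℂ); ℚ) = 0` in every odd degree `l > dim X` (given one datum `B`).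
[cite: VoisinHodgeII2003, Thm. 10.4 and Thm. 10.17] -/
theorem subsingleton_bettiCohomology_of_forall_blochSrinivas1983_of_lt (B : BettiHodgeData ℂ)
    (h : ∀ B' : BettiHodgeData ℂ, BlochSrinivas1983_hodgeNumbers_vanish_of_chowZeroSupported B')
    (hX : IsSmoothProjective n X) {l : ℕ} (hnl : n < l) (hl : Odd l) :
    Subsingleton (bettiCohomology X l) :=
  subsingleton_bettiCohomology_of_forall_blochSrinivas1983 B h hX
    (hasChowZeroSupportedInDimLE_self hX) hnl hl

/-- Betti cohomology `Hⁱ(X(ℂ); ℚ)` of a smooth projective `X` is finite-dimensional as soon as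
one Betti–Hodge datum `B` exists (Weil axiom (A) for `B.W`, transported along `B.iso`).
[cite: Kleiman1968, §1.2 (A)] -/
theorem finite_bettiCohomology (B : BettiHodgeData ℂ) (hX : IsSmoothProjective n X) (i : ℕ) :
    Module.Finite ℚ (bettiCohomology X i) := by
  haveI : Module.Finite ℚ (B.W.obj X i) := B.W.finite_obj hX i
  exact Module.Finite.of_surjective (B.isoObj X i).toLinearMap (B.isoObj X i).surjective

/-- Poincaré symmetry of the Betti numbers of `X(ℂ)`, `b_i(X) = b_j(X)` for `i + j = 2 dim X`,
given one Betti–Hodge datum `B` (Weil axiom (A) for `B.W`, `WeilCohomology.finrank_obj_eq_of_add_eq`,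
transported along `B.iso`). [cite: Kleiman1968, §1.2 (A)] -/
theorem finrank_bettiCohomology_eq_of_add_eq (B : BettiHodgeData ℂ) (hX : IsSmoothProjective n X)
    {i j : ℕ} (hij : i + j = 2 * n) :
    Module.finrank ℚ (bettiCohomology X i) = Module.finrank ℚ (bettiCohomology X j) := by
  rw [← (B.isoObj X i).finrank_eq, ← (B.isoObj X j).finrank_eq]
  exact B.W.finrank_obj_eq_of_add_eq hX hij

/-- **`∀ B, fact B` forces all odd Betti numbers off the middle degree to vanish:** for every
smooth projective `X` over `ℂ` of dimension `n` and every odd `j ≠ n`, `b_j(X) = 0` — above the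
middle by `subsingleton_bettiCohomology_of_forall_blochSrinivas1983_of_lt`, below it by Poincaré
duality `b_j = b_{2n-j}` (`2n - j` is again odd and `> n`).
[cite: VoisinHodgeII2003, Thm. 10.4 and Thm. 10.17] [cite: Kleiman1968, §1.2 (A)] -/
theorem finrank_bettiCohomology_eq_zero_of_forall_blochSrinivas1983 (B : BettiHodgeData ℂ)
    (h : ∀ B' : BettiHodgeData ℂ, BlochSrinivas1983_hodgeNumbers_vanish_of_chowZeroSupported B')
    (hX : IsSmoothProjective n X) {j : ℕ} (hj : Odd j) (hjn : j ≠ n) :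
    Module.finrank ℚ (bettiCohomology X j) = 0 := by
  rcases lt_or_gt_of_ne hjn with hlt | hgt
  · rw [finrank_bettiCohomology_eq_of_add_eq B hX (i := j) (j := 2 * n - j) (by omega)]
    haveI := subsingleton_bettiCohomology_of_forall_blochSrinivas1983_of_lt B h hX
      (l := 2 * n - j) (by omega) (Nat.Even.sub_odd (by omega) (even_two_mul n) hj)
    exact Module.finrank_zero_of_subsingleton
  · haveI := subsingleton_bettiCohomology_of_forall_blochSrinivas1983_of_lt B h hX hgt hj
    exact Module.finrank_zero_of_subsingleton

/-- In particular `∀ B, fact B` forces `b₁(X) = dim_ℚ H¹(X(ℂ); ℚ) = 0` for every smooth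
projective `X` over `ℂ` of dimension `≥ 2` — false for abelian surfaces (`b₁ = 4`) or `C × C'`
with `g(C) ≥ 1` (`b₁ = 2g + 2g'`). [cite: VoisinHodgeII2003, Thm. 10.4 and Thm. 10.17] -/
theorem finrank_bettiCohomology_one_eq_zero_of_forall_blochSrinivas1983 (B : BettiHodgeData ℂ)
    (h : ∀ B' : BettiHodgeData ℂ, BlochSrinivas1983_hodgeNumbers_vanish_of_chowZeroSupported B')
    (hX : IsSmoothProjective n X) (hn : 2 ≤ n) : Module.finrank ℚ (bettiCohomology X 1) = 0 :=
  finrank_bettiCohomology_eq_zero_of_forall_blochSrinivas1983 B h hX odd_one (by omega)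

/-- **Non-dischargeability, sharpened witness:** one Betti–Hodge datum `B` and ONE smooth
projective `X` over `ℂ` of dimension `≥ 2` with `H¹(X(ℂ); ℚ) ≠ 0` (any abelian variety of
dimension `≥ 2`, any product of curves of positive genus) refute
`∀ B, BlochSrinivas1983_hodgeNumbers_vanish_of_chowZeroSupported B`, the would-be `…_holds`.
[cite: VoisinHodgeII2003, Thm. 10.4 and Thm. 10.17] [cite: CarlsonMullerStachPeters2017, §3.5 eq. (3.5)] -/
theorem BlochSrinivas1983_hodgeNumbers_vanish_of_chowZeroSupported_not_forall_of_bettiOne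
    (B : BettiHodgeData ℂ) (hX : IsSmoothProjective n X) (hn : 2 ≤ n)
    (hb : Nontrivial (bettiCohomology X 1)) :
    ¬ ∀ B' : BettiHodgeData ℂ, BlochSrinivas1983_hodgeNumbers_vanish_of_chowZeroSupported B' := by
  intro h
  haveI := finite_bettiCohomology B hX 1
  exact (Module.finrank_pos (R := ℚ) (M := ↥(bettiCohomology X 1))).ne'
    (finrank_bettiCohomology_one_eq_zero_of_forall_blochSrinivas1983 B h hX hn)

end TrivialSupport

end Literature.Barriers.HodgeConjecture

end
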